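import Summits.ValiantsHypothesis.ValiantsHypothesis.Theorems.GrenetZeonDualUnipotentThreeHalvesWordFlagPencil

/-!
# `GrenetZeon.DualUnipotentThreeHalves` (stmt-ValiantsHypothesis-24318), R2 `HeavyTopLaw` — the INDEX-CORE certificate
# (R2's own currency `FlagCheap`): tops of uniformly small nilindex on a large direction space make the pencil flag-cheap

Port (val-lit merged desk, b71 (B) port pool; porter val-port-2 g3, 24318 line α lead; critic of record val-idea-crit-7 g2, price
P10-3′ of VERDICT #16a) of §3 of val-idea-26 g3's sorry-free crux workfile `Cruxes/DualUnipotentThreeHalves/NilCore.lean` @4763c601f003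
(card `Cruxes/DualUnipotentThreeHalves/Ideas/nil-core.md` rev 2, KEEP — PASS, V16/V16a), VERBATIM by name; crux workfiles are not
importable from `Theorems/`, hence the re-landing.  Texts and proofs are val-idea-26 g3's.

For R2's target `FlagCheap` (line-DEPENDENT flags) it suffices that every element of a top subspace `T` has NILINDEX `≤ a`: a letter
`Q` with `Q ^ a = 0` makes every word with a `Q`-run of length `≥ a` vanish, so a nonzero word has `#Q ≤ (a−1)·(#P+1)` — word-tame
profile `(r, c, Θ) = (a−1, 1, a−1)`, budget `⌊(a−1)n/a⌋`: the general-`a` version of ✓ `wordTame_of_sq_eq_zero` (`a = 2`) and the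
CONVERSE direction of ✓ `pow_eq_zero_of_wordTame`.  With ✓ `flagCheap_iff_wordCheap`:

* `count_true_add_le_of_pow_eq_zero`, `wordTame_of_pow_eq_zero` — index ⇒ word-tame;
* ★ `flagCheap_of_indexCore` — a top subspace `T` of nilindex `≤ a`, a direction space `K` with `N_lin(K) ⊆ T` and
  `(⌊(a−1)n/a⌋ + 1)·n < dim K` (informally `a·(codim T + n) < n²`) ⇒ `FlagCheap n m N`;
* `flagCheap_of_top_pow_eq_zero` — if EVERY top has nilindex `≤ a < n`, the pencil is flag-cheap with `K = ⊤` (budget `≤ n − 2`): R2's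
  residue consists of pencils with a top of nilindex `≥ n` on every large direction subspace («index-saturated» top spaces);
* `IndexCoreLaw` — the card's research residue as a TYPED CANDIDATE LAW (`def … : Prop`, NOT asserted, NOT a line): in the regime every
  IRREDUCIBLE affine nilpotent pencil has such an index-core.  CAUTION (crit-7 V16 (c), exact count): the certificate is FALSE on GENERIC
  dense subspaces of `𝔫_m` (no nonzero element of index `≤ n/2`), so the law lives entirely on «irreducible ⇒ far from generic»; it is
  the most killable of the typed laws of record (`NilCoreLaw ⇒ IndexCoreLaw ⇒ FlagCheap` on the irreducible locus; `DenseRatioLaw`;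
  `DimensionLaw`).  `flagCheap_of_indexCoreLaw` closes the irreducible locus from it in one line.

Census use (by name): the rows `U(p,k)`, `𝓘`, `𝓜_k` of `Cruxes/DualUnipotentThreeHalves/INSTANCES.md` are index-cores THEMSELVES
(`x^p ≡ 0` / `x³ ≡ 0` on the whole top space), hence flag-cheap for all `n > p` by `flagCheap_of_top_pow_eq_zero`.

Honest framing.  Helper lemmas + one typed candidate law (`--supports stmt-ValiantsHypothesis-24318 --as helper`); nothing here asserts
or proves `IndexCoreLaw`, R2 `HeavyTopLaw`, S1b, the crux, 8062 or `VP ≠ VNP` — all OPEN / NOT proved.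
[val-idea-26 g3, NilCore.lean §3; MOR 1991 Lemma 2; Radjavi–Rosenthal, Simultaneous Triangularization §1.4]
-/

-- single-conjunct layout: Sub = Summit, duplicated namespace component intended (the name is mandated)
set_option linter.dupNamespace false
set_option autoImplicit false

noncomputable section

namespace Summit.ValiantsHypothesis.ValiantsHypothesis.Theorems.GrenetZeon.IndexCore

open MvPolynomial Matrix
open Summit.ValiantsHypothesis.ValiantsHypothesis.Cruxes.TwoDimCoefficients.DimTwoCases (AffMat IsAffine)
open Summit.ValiantsHypothesis.ValiantsHypothesis.Theorems.GrenetZeon.RadicalSplit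

variable {m : ℕ}

/-! ## §1 Index ⇒ word-tame -/

/-- Run-length count: if `Q ^ a = 0` then a nonzero word has `#Q + j ≤ (a-1)·(#P + 1)` whenever it stays nonzero after `j` more
`Q`'s on the left (the invariant that makes the structural induction go through; use `j = 0`). [val-idea-26 g3] -/
theorem count_true_add_le_of_pow_eq_zero {a : ℕ} (P Q : Matrix (Fin m) (Fin m) ℂ) (hQ : Q ^ a = 0) :
    ∀ (w : List Bool) (j : ℕ), Q ^ j * word P Q w ≠ 0 → w.count true + j ≤ (a - 1) * (w.count false + 1)
  | [], j, h => by
    have hj : j < a := by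
      by_contra hja
      exact h (by rw [pow_eq_zero_of_le (not_lt.mp hja) hQ, zero_mul])
    simp only [List.count_nil, zero_add, mul_one]
    omega
  | true :: w, j, h => by
    have h' : Q ^ (j + 1) * word P Q w ≠ 0 := by
      rwa [word_cons, if_pos rfl, ← Matrix.mul_assoc, ← pow_succ] at h
    have ih := count_true_add_le_of_pow_eq_zero P Q hQ w (j + 1) h'
    simp only [List.count_cons_self]
    have hf : (true :: w).count false = w.count false := by simp
    rw [hf]; omega
  | false :: w, j, h => by
    have hj : j < a := by
      by_contra hja
      exact h (by rw [pow_eq_zero_of_le (not_lt.mp hja) hQ, zero_mul])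
    have hcons : word P Q (false :: w) = P * word P Q w := by simp [word_cons]
    have h' : Q ^ 0 * word P Q w ≠ 0 := by
      intro hw
      apply h
      rw [pow_zero, one_mul] at hw
      rw [hcons, hw, Matrix.mul_zero, Matrix.mul_zero]
    have ih := count_true_add_le_of_pow_eq_zero P Q hQ w 0 h'
    simp only [List.count_cons_self]
    have ht : (false :: w).count true = w.count true := by simp
    rw [ht]
    have : (a - 1) * (w.count false + 1 + 1) = (a - 1) * (w.count false + 1) + (a - 1) := by ring
    rw [this]; omega

/-- **Index ⇒ word-tame**: `Q ^ a = 0` (`1 ≤ a`) makes `(P, Q)` word-tame with budget `⌊(a-1)n/a⌋` (profile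
`(r, c, Θ) = (a-1, 1, a-1)`).  General-`a` version of ✓ `wordTame_of_sq_eq_zero`. [val-idea-26 g3] -/
theorem wordTame_of_pow_eq_zero {n k a : ℕ} (ha : 1 ≤ a) (hk : (a - 1) * n / a ≤ k) (P Q : Matrix (Fin m) (Fin m) ℂ)
    (hQ : Q ^ a = 0) : WordTame n k P Q := by
  refine ⟨a - 1, 1, a - 1, le_rfl, ?_, fun w hw => ?_⟩
  · have h1 : 1 + (a - 1) = a := by omega
    rw [h1]
    rcases Nat.eq_zero_or_pos n with rfl | hn
    · rw [Nat.div_eq_of_lt (by omega)]; exact Nat.zero_le _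
    · have h2 : a - 1 + (a - 1) * (n - 1) = (a - 1) * n := by
        calc a - 1 + (a - 1) * (n - 1) = (a - 1) * (n - 1 + 1) := by ring
          _ = (a - 1) * n := by rw [Nat.sub_add_cancel hn]
      rw [h2]; exact hk
  · have := count_true_add_le_of_pow_eq_zero P Q hQ w 0 (by rwa [pow_zero, one_mul])
    simp only [add_zero, one_mul] at this ⊢
    calc w.count true ≤ (a - 1) * (w.count false + 1) := this
      _ = a - 1 + (a - 1) * w.count false := by ring

/-! ## §2 The index-core certificate -/

/-- ★ **INDEX-CORE CERTIFICATE.**  A subspace `T` of matrices of nilindex `≤ a`, a direction space `K` whose tops lie in `T`,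
and the budget `(⌊(a-1)n/a⌋ + 1)·n < dim K` (informally `a·(codim T + n) < n²`) make the affine pencil flag-cheap. [val-idea-26 g3] -/
theorem flagCheap_of_indexCore {n : ℕ} (N : AffMat n m) (hN : IsAffine N) (T : Submodule ℂ (Matrix (Fin m) (Fin m) ℂ))
    (a : ℕ) (ha : 1 ≤ a) (hT : ∀ Q ∈ T, Q ^ a = 0) (K : Submodule ℂ (Fin n × Fin n → ℂ))
    (hK : ∀ v ∈ K, linPart N v ∈ T) (hdim : ((a - 1) * n / a + 1) * n < Module.finrank ℂ K) : FlagCheap n m N :=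
  (flagCheap_iff_wordCheap N hN).2 ⟨K, (a - 1) * n / a, hdim, fun _ v hv => wordTame_of_pow_eq_zero ha le_rfl _ _ (hT _ (hK v hv))⟩

/-- **ALL TOPS SHORT ⇒ CHEAP.**  If every top `N_lin(v)` of an affine pencil has nilindex `≤ a` with `1 ≤ a < n`, the pencil is
flag-cheap with `K = ⊤` and budget `⌊(a-1)n/a⌋ ≤ n - 2`.  So R2's residue consists of pencils with a top of nilindex `≥ n`
on every large direction subspace («index-saturated» top spaces). [val-idea-26 g3] -/
theorem flagCheap_of_top_pow_eq_zero {n : ℕ} (N : AffMat n m) (hN : IsAffine N) (a : ℕ) (ha : 1 ≤ a) (han : a < n)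
    (h : ∀ v : Fin n × Fin n → ℂ, (linPart N v) ^ a = 0) : FlagCheap n m N := by
  refine (flagCheap_iff_wordCheap N hN).2 ⟨⊤, (a - 1) * n / a, ?_, fun _ v _ => wordTame_of_pow_eq_zero ha le_rfl _ _ (h v)⟩
  have hk : (a - 1) * n / a < n - 1 := by
    rw [Nat.div_lt_iff_lt_mul (by omega)]
    have h1 : (a - 1) * n + n = a * n := by
      calc (a - 1) * n + n = (a - 1 + 1) * n := by ring
        _ = a * n := by rw [Nat.sub_add_cancel ha]
    have h2 : (n - 1) * a + a = a * n := by
      calc (n - 1) * a + a = (n - 1 + 1) * a := by ring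
        _ = a * n := by rw [Nat.sub_add_cancel (by omega)]; ring
    omega
  rw [finrank_top, Module.finrank_fintype_fun_eq_card, Fintype.card_prod, Fintype.card_fin]
  calc ((a - 1) * n / a + 1) * n ≤ (n - 1) * n := Nat.mul_le_mul_right _ (by omega)
    _ < n * n := Nat.mul_lt_mul_of_pos_right (by omega) (by omega)

/-! ## §3 The typed candidate law (NOT asserted) -/

/-- **`IndexCoreLaw`** — val-idea-26 g3's research residue as a CANDIDATE law (a `Prop`; NOT asserted, NOT a line of record): in the regime
`C₀·m² < n³` every IRREDUCIBLE (`𝒜(N) = M_m`) affine nilpotent pencil has a top subspace `T ⊇ N_lin(K)` of uniformly small nilindex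
`≤ a` with `(⌊(a−1)n/a⌋ + 1)·n < dim K` — informally «short index-core of codim `≲ n²/a`».  CAUTION (crit-7 g2 V16 (c), exact count):
the certificate is FALSE on GENERIC dense linear subspaces of `𝔫_m` at `dim = n²`, `m = n^{3/2}` (they contain no nonzero element of
index `≤ n/2`), so the law rests entirely on «irreducible at this density ⇒ far from generic» — an explicit, attackable bet; weaker than
the card's `NilCoreLaw`, and sufficient for R2 on the irreducible locus (`flagCheap_of_indexCoreLaw`). [val-idea-26 g3] -/
def IndexCoreLaw : Prop :=
  ∃ C₀ n₀ : ℕ, ∀ n ≥ n₀, ∀ m : ℕ, C₀ * m ^ 2 < n ^ 3 → ∀ N : AffMat n m, IsAffine N → N ^ m = 0 → pencilAlg N = ⊤ →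
    ∃ (T : Submodule ℂ (Matrix (Fin m) (Fin m) ℂ)) (a : ℕ) (K : Submodule ℂ (Fin n × Fin n → ℂ)),
      1 ≤ a ∧ (∀ Q ∈ T, Q ^ a = 0) ∧ (∀ v ∈ K, linPart N v ∈ T) ∧ ((a - 1) * n / a + 1) * n < Module.finrank ℂ K

/-- The candidate law closes R2 on the irreducible locus (one line from ★). [val-idea-26 g3] -/
theorem flagCheap_of_indexCoreLaw (h : IndexCoreLaw) :
    ∃ C₀ n₀ : ℕ, ∀ n ≥ n₀, ∀ m : ℕ, C₀ * m ^ 2 < n ^ 3 → ∀ N : AffMat n m, IsAffine N → N ^ m = 0 → pencilAlg N = ⊤ →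
      FlagCheap n m N := by
  obtain ⟨C₀, n₀, h⟩ := h
  refine ⟨C₀, n₀, fun n hn m' hm N hN hnil hirr => ?_⟩
  obtain ⟨T, a, K, ha, hT, hK, hdim⟩ := h n hn m' hm N hN hnil hirr
  exact flagCheap_of_indexCore N hN T a ha hT K hK hdim

end Summit.ValiantsHypothesis.ValiantsHypothesis.Theorems.GrenetZeon.IndexCore

end
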